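import Literature.Probability.RandomPlanarGeometry.SLETransienceLemma73GtEight
import Literature.Probability.RandomPlanarGeometry.SLETransienceFromTraceExistence
import HarnessLib

/-!
# Transience of the SLE₈ trace (Rohde–Schramm (2005), Thm. 7.1, Update): the named fact, discharged

Trunk T-STOCH; theorems only (no definition, no new named fact). We **discharge** the named fact
`Literature.Probability.RandomPlanarGeometry.RohdeSchramm2005_thm71_eight` of `SLETransience.lean`
— S. Rohde, O. Schramm, *Basic properties of SLE*, Ann. of Math. 161 (2005), Thm. 7.1 at `κ = 8`
as asserted by the Update (p. 911): "it follows from [LSW] that Theorem 5.2 (Hölder continuity)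
holds for `κ = 8` … Theorem 7.1 for `κ = 8` follows by applying the argument for `κ > 8`" — i.e.
`HasSLETrace 8 → a.s. |γ(t)| → ∞`:

* `RohdeSchramm2005_thm71_eight_holds`. The whole printed route is in the tree:
  `SLETransienceKappaEight.lean` (the `κ > 8` argument of Lemma 7.3, p. 910, run at `κ = 8`:
  Thm. 6.4, Lemma 6.5 / no bubbles for `κ ≥ 8`, the Markov property at fixed rational times,
  Fubini; absurd unless `area(∂Kₜ) > 0` with positive probability), `SLEHullBoundaryArea.lean`
  (Cor. 5.3 at `κ = 8`, `area(∂Kₜ) = 0` a.s., from Thm. 5.2's Hölder regularity of `f̂ₜ` — (5.4) by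
  Borel–Cantelli over the derivative estimate Cor. 3.5 on a plane grid and Koebe distortion — and
  the porosity/Lebesgue-density lemma of `Analysis/Complex/HolderBoundaryArea.lean` replacing
  Jones–Makarov), assembled there as `RohdeSchramm2005_thm71_eight_of_cor35`; and Cor. 3.5 itself is
  now the theorem `RohdeSchramm2005_cor35_holds` (`RohdeSchrammCor35Proofs.lean`).

Consequences recorded with the remaining inputs made explicit:

* `ae_volume_frontier_sleHull_eq_zero_of_eight_le` / `…_of_eight_lt` — Cor. 5.3 (its "in
  particular, a.s. `area ∂Kₜ = 0`") for every `κ ≥ 8` whose chain is a.s. generated by a curve,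
  unconditionally for `κ > 8` (Thm. 5.1, `hasSLETrace_of_ne_eight_apply`);
* `tendsto_norm_sleTrace_atTop_of_ne_eight` — **Thm. 7.1 for every `κ > 0`, `κ ≠ 8`,
  unconditionally**;
* `tendsto_norm_sleTrace_atTop_of_hasSLETrace_eight` — the target fact `tendsto_norm_sleTrace_atTop`
  (Thm. 7.1 for all `κ > 0`) from Lawler–Schramm–Werner's Thm. 4.7 (`hasSLETrace_eight`) **alone**.

## References

* S. Rohde, O. Schramm, *Basic properties of SLE*, Ann. of Math. 161 (2005) 883–924
  (arXiv:math/0106036): Cor. 3.5, Thm. 5.1, Thm. 5.2, Cor. 5.3, Lemma 7.3, Thm. 7.1 and the Update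
  (p. 911).
* G. F. Lawler, O. Schramm, W. Werner, *Conformal invariance of planar loop-erased random walks and
  uniform spanning trees*, Ann. Probab. 32 (2004), Thm. 4.7.
-/

noncomputable section

open Filter MeasureTheory
open scoped NNReal

namespace Literature.Probability.RandomPlanarGeometry

variable {κ : ℝ≥0}

/-! ### The discharge -/

/-- **Rohde–Schramm (2005), Thm. 7.1 at `κ = 8` (the Update, p. 911), holds**: if SLE₈ is
generated by a curve then almost surely `|γ(t)| → ∞`. The named fact `RohdeSchramm2005_thm71_eight`
of `SLETransience.lean`, discharged: `RohdeSchramm2005_thm71_eight_of_cor35` (Lemma 7.3's `κ > 8`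
argument at `κ = 8` + Cor. 5.3 at `κ = 8` from Thm. 5.2, all proved in the tree) fed with the
theorem `RohdeSchramm2005_cor35_holds` (Cor. 3.5).
[cite: RohdeSchramm2005, Thm 7.1 and Update (p. 911)] -/
theorem RohdeSchramm2005_thm71_eight_holds : RohdeSchramm2005_thm71_eight :=
  RohdeSchramm2005_thm71_eight_of_cor35 (RohdeSchramm2005_cor35_holds _)

/-! ### Cor. 5.3 (null area of the hull frontier) for `κ ≥ 8` -/

/-- **Rohde–Schramm (2005), Cor. 5.3 ("in particular, a.s. `area ∂Kₜ = 0`") for every `κ ≥ 8`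
whose chain is a.s. generated by a curve**: for every `t`, almost surely the frontier of the SLE_κ
hull `Kₜ` is Lebesgue-null (`ae_volume_frontier_sleHull_eq_zero_of_cor35`, from Thm. 5.2's Hölder
regularity and the porosity/density lemma, fed with `RohdeSchramm2005_cor35_holds`). At `κ = 8` the
hypothesis `HasSLETrace 8` is [LSW] Thm. 4.7. [cite: RohdeSchramm2005, Cor 5.3] -/
theorem ae_volume_frontier_sleHull_eq_zero_of_eight_le (h0 : HasSLETrace κ) (hκ : 8 ≤ κ) (t : ℝ≥0) :
    ∀ᵐ ω ∂Process.preWienerMeasure, volume (frontier (sleHull κ ω t)) = 0 :=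
  ae_volume_frontier_sleHull_eq_zero_of_cor35 (RohdeSchramm2005_cor35_holds _) hκ h0 t

/-- **Rohde–Schramm (2005), Cor. 5.3 for `κ > 8`, unconditionally**: for every `t`, almost surely
`area(∂Kₜ) = 0` (the trace exists by Thm. 5.1, `hasSLETrace_of_ne_eight_apply`).
[cite: RohdeSchramm2005, Cor 5.3] -/
theorem ae_volume_frontier_sleHull_eq_zero_of_eight_lt (hκ : 8 < κ) (t : ℝ≥0) :
    ∀ᵐ ω ∂Process.preWienerMeasure, volume (frontier (sleHull κ ω t)) = 0 :=
  ae_volume_frontier_sleHull_eq_zero_of_eight_le (hasSLETrace_of_ne_eight_apply hκ.ne') hκ.le t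

/-! ### Thm. 7.1 -/

/-- **Rohde–Schramm (2005), Thm. 7.1 for `κ ≠ 8`, unconditionally**: for every `κ > 0`, `κ ≠ 8`,
almost surely `|γ(t)| → ∞` (`tendsto_norm_sleTrace_atTop_of_cor35_of_ne_eight` fed with
`RohdeSchramm2005_cor35_holds`). [cite: RohdeSchramm2005, Thm 7.1] -/
theorem tendsto_norm_sleTrace_atTop_of_ne_eight (hκ0 : 0 < κ) (hκ8 : κ ≠ 8) :
    ∀ᵐ ω ∂Process.preWienerMeasure, Tendsto (fun t ↦ ‖sleTrace κ ω t‖) atTop atTop :=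
  tendsto_norm_sleTrace_atTop_of_cor35_of_ne_eight (RohdeSchramm2005_cor35_holds _) hκ0 hκ8

/-- **The target fact `tendsto_norm_sleTrace_atTop` (Rohde–Schramm (2005), Thm. 7.1 with the
Update: for every `κ > 0`, a.s. `|γ(t)| → ∞`) from Lawler–Schramm–Werner's Thm. 4.7 alone**
(`hasSLETrace_eight`: SLE₈ is generated by a curve): `tendsto_norm_sleTrace_atTop_of_cor35_of_eight`
fed with `RohdeSchramm2005_cor35_holds`.
[cite: RohdeSchramm2005, Thm 7.1 and Update (p. 911)] -/
theorem tendsto_norm_sleTrace_atTop_of_hasSLETrace_eight (h8e : hasSLETrace_eight) :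
    tendsto_norm_sleTrace_atTop :=
  tendsto_norm_sleTrace_atTop_of_cor35_of_eight (RohdeSchramm2005_cor35_holds _) h8e

/-! ### Appended 2026-08-16 (librarian, fact-decompose `libsplit-37`): the registered split of `tendsto_norm_sleTrace_atTop` -/

/-- **Registered decomposition of the named fact `tendsto_norm_sleTrace_atTop`** (Rohde–Schramm
(2005), Thm. 7.1 with the Update, p. 911: for every `κ > 0`, a.s. `|γ(t)| → ∞`; `SLE.lean`). Along
the printed proof every layer is a theorem of the tree (Cor. 3.5, Thm. 5.1 for `κ ≠ 8`, Thm. 5.2,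
Cor. 5.3, Lemma 7.3, the Update's `κ = 8` argument) except ONE named fact, its single child:

* `hasSLETrace_eight` — SLE₈ is generated by a curve (Lawler–Schramm–Werner (2004), Thm. 4.7:
  the scaling limit of the uniform spanning tree Peano curve), the input the Update cites as
  "it follows from [LSW] that Theorem 5.2 holds for `κ = 8`".

This theorem is `tendsto_norm_sleTrace_atTop_of_hasSLETrace_eight` under the `_holds_of` name by
which the split is recorded; nothing new is claimed.
[cite: RohdeSchramm2005, Thm 7.1 and Update (p. 911)] [cite: LawlerSchrammWerner2004, Thm 4.7] -/
theorem tendsto_norm_sleTrace_atTop_holds_of (h8e : hasSLETrace_eight) :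
    tendsto_norm_sleTrace_atTop :=
  tendsto_norm_sleTrace_atTop_of_hasSLETrace_eight h8e

end Literature.Probability.RandomPlanarGeometry

end
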